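import Mathlib
import Summits.Ventures.PercRepro2.K5HyperB25Defs
import Summits.Ventures.PercRepro2.K5HyperI
import Summits.Ventures.PercRepro2.K5K3Kernel

/-!
# THE CRUX KERNEL'S `TvT-TRI` IN BASE `2^25`
(blind cell PercRepro2, typer-1 g10; mine-1 §23.12)

`TvT-TRI` sums `300` masked triple counts per side (crude bound `300 · 3^10 ≈ 17.7 M > 2^23`), so its
certificate lives in base `KB5 = 2^25` (`K5HyperB25Defs.lean`): `posOn35 / negOn35` are the `10 + 10` products of the
`K₃` tables through the masks with `kron35`, and `kPosTvT35 / kNegTvT35` the two sides.  Certificates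
`cert_TvT35_abc : CertLE5 (kNegTvT35 a b c) (kPosTvT35 a b c)` (`K5HyperCertK3TvT25*.lean`, one big triangle
per file, `maxHeartbeats 0`).  (`M-TRI` with `120` counts per side stays in base `2^23`, `K5HyperK3Cmp.lean`.)
-/

namespace Summit.Ventures.PercRepro2

namespace K5

/-- The positive products of `K₃` on the pattern (base `2^25`) `(S₁, S₂, S₃)` (marks `(0, 1, 2, 3, 4)`). -/
def posOn35 (S₁ S₂ S₃ : Fin 10 → Bool) : ℕ :=
  kron35 tPD S₁ * kron35 tQ S₂ * kron35 (t4p 4) S₃ + kron35 tQ S₁ * kron35 tPDoU S₂ * kron35 (t5p 4) S₃ +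
    kron35 tPD S₁ * kron35 tQ S₂ * kron35 (t6m 4) S₃ +
    kron35 tPD S₁ * kron35 (t7p 4) S₂ * kron35 (t7m 0) S₃ + kron35 tPD S₁ * kron35 (t7m 4) S₂ * kron35 (t7p 0) S₃ +
    kron35 tPDoU S₁ * kron35 (t7p 4) S₂ * kron35 (t7m 3) S₃ + kron35 tPDoU S₁ * kron35 (t7m 4) S₂ * kron35 (t7p 3) S₃ +
    kron35 tPD S₁ * kron35 (t7p 4) S₂ * kron35 t10p S₃ + kron35 tPD S₁ * kron35 (t7m 4) S₂ * kron35 t10m S₃ +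
    kron35 tQ S₁ * kron35 (t12 4) S₂ * kron35 tPDoU S₃

/-- The negative products of `K₃` on the pattern (base `2^25`) `(S₁, S₂, S₃)`. -/
def negOn35 (S₁ S₂ S₃ : Fin 10 → Bool) : ℕ :=
  kron35 tPD S₁ * kron35 tQ S₂ * kron35 (t4m 4) S₃ + kron35 tQ S₁ * kron35 tPDoU S₂ * kron35 (t5m 4) S₃ +
    kron35 tPD S₁ * kron35 tQ S₂ * kron35 (t6p 4) S₃ +
    kron35 tPD S₁ * kron35 (t7p 4) S₂ * kron35 (t7p 0) S₃ + kron35 tPD S₁ * kron35 (t7m 4) S₂ * kron35 (t7m 0) S₃ +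
    kron35 tPDoU S₁ * kron35 (t7p 4) S₂ * kron35 (t7p 3) S₃ + kron35 tPDoU S₁ * kron35 (t7m 4) S₂ * kron35 (t7m 3) S₃ +
    kron35 tPD S₁ * kron35 (t7p 4) S₂ * kron35 t10m S₃ + kron35 tPD S₁ * kron35 (t7m 4) S₂ * kron35 t10p S₃ +
    kron35 tPD S₁ * kron35 tQ S₂ * kron35 (t11 4) S₃

/-- **`TvT-TRI ≥ 0` as base-`2^25` Kronecker numbers**: `kPosTvT35 = N(H+△(1,1,1))⁺ + N(H+T(1))⁻`. -/
def kPosTvT35 (a b c : ℕ) : ℕ :=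
  sumE3 posOn35 (pairMask a b) (pairMask a c) (pairMask b c) + sumT1 negOn35 (triMask a b c)

/-- The other side of `TvT-TRI`. -/
def kNegTvT35 (a b c : ℕ) : ℕ :=
  sumE3 negOn35 (pairMask a b) (pairMask a c) (pairMask b c) + sumT1 posOn35 (triMask a b c)

end K5

end Summit.Ventures.PercRepro2
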